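import Summits.QuantumFields.YangMills.Theorems.LangevinControlUVFemtoCurvatureTwoPointCUniformDoublingAll
import Summits.QuantumFields.YangMills.Theorems.LangevinControlUVFemtoCurvatureTwoPointCCornerBridge
import HarnessLib

/-!
# Route `LangevinControlUV`, crux `FemtoCurvatureTwoPointC` (stmt-QuantumFields-16204), line
# `conditional-covariance-floor` — stub V-corner `stub_varianceCeilingCorner` CLOSED

The skeleton stub V-corner (reshape v3), verbatim: for a compact simple Lie group `G`, a lattice
representation `r` and a GIVEN box coupling `u` with constants `u₀ β₀ κ₁ κ₂ κ₃ c C c₈` carrying the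
R-bundle, there are `β₁ C'` with `Var_{L,β}(P_0^{01}) = E(P_0·P_0) − E(P_0)² ≤ C'·u(8,β)²` on every window
box `L ≥ 8` in the deep-femto corner `L⁴ < log β`.

**Proof.** The landed bridge `varianceCeilingCorner_of_uniformDoublingCorner` (`…CCornerBridge`,
p162787) reduces the stub to the uniform corner doubling UDC
(`∃ A, ∀ L ≥ 2, β ≥ 2, L⁴ < log β → Z_L(β/2) ≤ e^{A L⁴} Z_L(β)` for every compact second-countable `G`
and lattice representation `r`), and UDC is `TorusGauge.uniformDoubling_corner` (`…CUniformDoublingAll`):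
the uniform torus doubling on ALL boxes `TorusGauge.uniformDoubling_all` — holonomy-conditioned torus
sandwich (`torus_upper_axisHolonomy` via the lattice Stokes bound `axisCommutatorCost_le_wilsonAction`,
`torus_lower_axisHolonomy` via the hyperplane twist in the comb gauge) plus the iterated one-site
doubling `oneSite_partitionFunction_doubling` (conical sublevel doubling of the commutator cost on `G⁴`).
With this file the variance clause V of `AFProfilesCore` is proved on ALL window boxes (even bulk/mid
p150733/p155166, odd bulk p161704, corner here). No named facts, no definitions.
-/

set_option autoImplicit false

noncomputable section

open Literature.MathematicalPhysics.QuantumFieldTheory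

namespace Summit.QuantumFields.YangMills.Theorems.FemtoCurvatureTwoPointC

/-- **V-corner — the variance ceiling in the deep-femto (holonomy) corner, BOTH parities** (skeleton
stub `stub_varianceCeilingCorner` of crux `FemtoCurvatureTwoPointC`, line `conditional-covariance-floor`,
reshape v3; the registered statement verbatim): for every compact simple `G`, lattice representation
`r` and EVERY coupling `u` with the R-properties, beyond a threshold
`Var_{L,β}(P_0^{01}) ≤ C'·u(8,β)²` on window boxes `L ≥ 8` with `L⁴ < log β` — the bridge
`varianceCeilingCorner_of_uniformDoublingCorner` applied to the uniform corner doubling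
`TorusGauge.uniformDoubling_corner`. -/
theorem stub_varianceCeilingCorner :
    ∀ (G : Type) [Group G] [TopologicalSpace G] [IsTopologicalGroup G] [CompactSpace G]
        [MeasurableSpace G] [BorelSpace G], IsCompactSimpleLieGroup G →
        ∀ r : LatticeRep G, ∀ (u : ℕ → ℝ → ℝ) (u₀ β₀ κ₁ κ₂ κ₃ c C c₈ : ℝ),
      (0 < u₀ ∧ 0 < c ∧ 0 < κ₁ ∧ 0 ≤ κ₃ ∧ 0 < c₈ ∧
        (∀ (L : ℕ) (β : ℝ), 8 ≤ L → β₀ ≤ β → 0 < u L β) ∧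
        (∀ L : ℕ, 8 ≤ L → ContinuousOn (u L) (Set.Ici β₀)) ∧
        (∀ L : ℕ, 8 ≤ L → Filter.Tendsto (u L) Filter.atTop (nhds 0)) ∧
        (∀ β : ℝ, β₀ ≤ β → c₈ ≤ β * u 8 β) ∧
        (∀ (L L' : ℕ) (β : ℝ), β₀ ≤ β → 8 ≤ L → L ≤ L' → L' ≤ 2 * L →
            (∀ M : ℕ, 8 ≤ M → M ≤ L → u M β ≤ u₀) → |(u L β)⁻¹ - (u L' β)⁻¹| ≤ κ₂) ∧
        (∀ (k m : ℕ) (β : ℝ), β₀ ≤ β → (∀ M : ℕ, 8 ≤ M → M ≤ 8 * 2 ^ (k + m) → u M β ≤ u₀) →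
            κ₁ * m - κ₃ ≤ (u (8 * 2 ^ k) β)⁻¹ - (u (8 * 2 ^ (k + m)) β)⁻¹ ∧
              (u (8 * 2 ^ k) β)⁻¹ - (u (8 * 2 ^ (k + m)) β)⁻¹ ≤ κ₂ * m + κ₃) ∧
        (∀ (L : ℕ) [NeZero L] (β : ℝ), β₀ ≤ β → 8 ≤ L →
            (∀ M : ℕ, 8 ≤ M → M ≤ L → u M β ≤ u₀) →
            ∀ (P : (Fin 4 → ZMod L) → Fin 4 → Fin 4 → GaugeConfig 4 L G → ℝ)
              (E : (GaugeConfig 4 L G → ℝ) → ℝ),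
              (P = fun x i j U => (r.N : ℝ) - (r.ρ (plaquetteHolonomy U x i j)).trace.re) →
              (E = fun F => wilsonExpectation r.ρ β F) →
              c * u L β ^ 2 ≤
                ((L / 8 : ℕ) : ℝ) ^ 8 * (E (fun U => P 0 0 1 U * P (Pi.single (2 : Fin 4) ((L / 8 : ℕ) : ZMod L)) 0 1 U)
                  - E (P 0 0 1) * E (P (Pi.single (2 : Fin 4) ((L / 8 : ℕ) : ZMod L)) 0 1)) ∧
              ((L / 8 : ℕ) : ℝ) ^ 8 * (E (fun U => P 0 0 1 U * P (Pi.single (2 : Fin 4) ((L / 8 : ℕ) : ZMod L)) 0 1 U)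
                - E (P 0 0 1) * E (P (Pi.single (2 : Fin 4) ((L / 8 : ℕ) : ZMod L)) 0 1)) ≤ C * u L β ^ 2)) →
      ∃ (β₁ C' : ℝ),
        (∀ (L : ℕ) [NeZero L] (β : ℝ), β₁ ≤ β → 8 ≤ L → (L : ℝ) ^ 4 < Real.log β →
            (∀ M : ℕ, 8 ≤ M → M ≤ L → u M β ≤ u₀) →
            ∀ (P : (Fin 4 → ZMod L) → Fin 4 → Fin 4 → GaugeConfig 4 L G → ℝ)
              (E : (GaugeConfig 4 L G → ℝ) → ℝ),
              (P = fun x i j U => (r.N : ℝ) - (r.ρ (plaquetteHolonomy U x i j)).trace.re) →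
              (E = fun F => wilsonExpectation r.ρ β F) →
              E (fun U => P 0 0 1 U * P 0 0 1 U) - E (P 0 0 1) * E (P 0 0 1) ≤ C' * u 8 β ^ 2) :=
  varianceCeilingCorner_of_uniformDoublingCorner TorusGauge.uniformDoubling_corner

end Summit.QuantumFields.YangMills.Theorems.FemtoCurvatureTwoPointC

end
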